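import Literature.NumberTheory.EllipticCurves.AtkinLehnerSymbolSymmetryProofs
import Literature.NumberTheory.EllipticCurves.PAdicMeasureFunctionalEquationProofs
import Literature.NumberTheory.EllipticCurves.PAdicLFunctionNonsplitMultiplicativeExistenceProofs
import Literature.NumberTheory.EllipticCurves.PAdicMeasureMoments
import Literature.NumberTheory.EllipticCurves.PAdicPowerSeriesZeros
import HarnessLib

/-!
# The functional equation of `L_p(E, T)` at a prime `p ‖ N` of MULTIPLICATIVE reduction
# (Mazur–Tate–Teitelbaum 1986, §I.17)

Topic `NumberTheory/EllipticCurves` (the `p`-adic `L`-function at a multiplicative prime: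
`IsSplitMultPAdicLFunctionOf` of `PAdicBSD`, `IsMultPAdicLFunctionOf` of
`PAdicLFunctionMultiplicativeInterpolation`). Theorems only. The tree's functional equation
`subst_padicLFunction_eq_of_symmetry` / `PAdicFunctionalEquationParityProofs` concerns the
good-reduction function `padicLFunction f α` (`p ∤ N`, Fricke symmetry `x ↦ −1/(Nx)`, multiplier
`⟨N⟩`). At a prime `p ‖ N`, `N = pM`, THE `p`-adic `L`-function of the pair is the Mellin transform
of the ONE-term measure `μ(a + p^nℤ_p) = α^{-n}[a/p^n]⁺` (`ε(p) = 0` in MTT (10.1), `α = a_p = ±1`),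
characterised inside `Λ ⊗ ℚ_p` by its interpolation package; its symmetry is the Atkin–Lehner one at
the prime-to-`p` part `M` of the level (`ratPlusSymbol_eq_mul_of_atkinLehner_of_dvd`:
`[u/p^n]⁺ = σ[u'/p^n]⁺` for `M u u' ≡ −1`, `w_M f = −σ f`), the multiplier is `⟨M⟩ = γ^c`, and the
functional equation reads **`L(ι(T)) = σ · (1 + T)^c · L(T)`**, `ι = (1+T)⁻¹ − 1`
(Mazur–Tate–Teitelbaum 1986, §I.17; in Greenberg's variable, `L_p(E, 2 − s) = σ ⟨M⟩^{s−1} L_p(E, s)`).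
For the newform of an elliptic curve `σ = −ε_M = −a_p · w_E`: at a SPLIT multiplicative prime the
`p`-adic sign is the OPPOSITE of the complex root number (the trivial zero; Mazur–Tate–Teitelbaum
§I.15, §II; Greenberg–Stevens 1993), at a non-split prime it is the root number.

* `exists_isSplitMultPAdicLFunctionOf_subst_eq`, `exists_isMultPAdicLFunctionOf_neg_one_subst_eq` —
  the Mellin transform of the (signed) measure satisfies the package AND the functional equation
  (`exists_powerSeries_of_bounded_distribution'` + `subst_eq_of_measure_symmetry`);
* `IsMultPAdicLFunctionOf.unique` — uniqueness of the package (`MemIwasawaRat.eq_zero_of_forall_hasSum_zero`);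
* `IsSplitMultPAdicLFunctionOf.subst_eq_of_atkinLehner`,
  `IsMultPAdicLFunctionOf.subst_eq_of_atkinLehner` — **the functional equation for EVERY `L` of
  the package** (by uniqueness).

## References

* B. Mazur, J. Tate, J. Teitelbaum, *On `p`-adic analogues of the conjectures of Birch and
  Swinnerton-Dyer*, Invent. Math. 84 (1986), 1–48, §I.10 (Prop.), §I.11–I.14 ((14.3)), §I.15, §I.17.
* R. Greenberg, *Iwasawa theory for elliptic curves*, LNM 1716 (1999), §1 (pp. 67–68), §4 (PDF p. 113).
* R. Greenberg, G. Stevens, *`p`-adic `L`-functions and `p`-adic periods of modular forms*, Invent.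
  Math. 111 (1993), Introduction.
* D. Delbourgo, *Elliptic curves and big Galois representations*, LMS LN 356 (2008), §2.1 and §4.3
  (the `W_N`-sign `−√(ε(−N))ψ⁻¹(−N)⟨−N⟩^{k/2−s}` of the two-variable functional equation, `N` the
  tame level).
-/

noncomputable section

open scoped MatrixGroups ModularForm

open Filter Topology PowerSeries CongruenceSubgroup Literature.NumberTheory.EllipticCurves.ModularForms

namespace Literature.NumberTheory.EllipticCurves

section Main

variable {W : WeierstrassCurve ℚ} {p : ℕ} [Fact p.Prime] {N : ℕ} [NeZero N]
  {f : CuspForm (Gamma0 N) 2} {M : ℕ} [NeZero M]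

/-- **Functional equation at a SPLIT multiplicative prime, for the Mellin transform of the measure.**
Let `E/ℚ` have split multiplicative reduction at `p`, `f` its newform of level `N = pM`, `p ∤ M`,
with `w_M f = -σ f` (`σ = ±1`), and `⟨M⟩ = γ^c` (`hc`). Then some `L` with
`IsSplitMultPAdicLFunctionOf f p L` — the Mellin transform of the measure `μ_n(a) = [a/p^n]⁺`
(Mazur–Tate–Teitelbaum 1986, §I.10 with `ε(p) = 0`, `α = a_p = 1`) — satisfies
`L(ι(T)) = σ (1+T)^c L(T)`: the measure is bounded (Manin–Drinfeld), its Riemann sums converge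
(`exists_powerSeries_of_bounded_distribution'`), and it is `σ`-symmetric under `x ↦ -1/(Mx)`
(`ratPlusSymbol_eq_mul_of_atkinLehner_of_dvd`), so `subst_eq_of_measure_symmetry` applies.
[cite: MazurTateTeitelbaum1986Invent, §I.10 Prop., §I.14 (14.3), §I.17] -/
theorem exists_isSplitMultPAdicLFunctionOf_subst_eq (hsplit : W.HasSplitMultiplicativeReductionAtPrime p)
    (hf : IsNewformOf W f) (hNM : N = p * M) (hpM : ¬ p ∣ M) {σ : ℤ} (hσ : σ ^ 2 = 1)
    (hW : atkinLehnerInvolution N 2 M f = (-(σ : ℂ)) • f)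
    {ηM : rootsOfUnity (torsionOrder p) ℤ_[p]} {c : ℤ_[p]}
    (hc : ∀ n : ℕ, PadicInt.toZModPow (n + cyclotomicExponent p) ((ηM : ℤ_[p]ˣ) : ℤ_[p]) *
        (cyclotomicGenerator p : ZMod (p ^ (n + cyclotomicExponent p))) ^ (PadicInt.toZModPow n c).val =
          (M : ZMod (p ^ (n + cyclotomicExponent p))))
    {ι : ℚ_[p]⟦X⟧} (hι : (1 + X : ℚ_[p]⟦X⟧) * (ι + 1) = 1) :
    ∃ L : PowerSeries ℚ_[p], IsSplitMultPAdicLFunctionOf f p L ∧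
      PowerSeries.subst ι L = C ((σ : ℤ) : ℚ_[p]) * PowerSeries.binomialSeries ℚ_[p] c * L := by
  have hQ : coeffField f = ⊥ := hf.coeffField_eq_bot
  have hrat : ∀ r : ℚ, (ratPlusSymbol f r : ℝ) = normalizedPlusSymbol f r :=
    ratCast_ratPlusSymbol_holds hf.1 hQ
  have hap : cuspCoeff f p = 1 := (hf.cuspCoeff_eq_one_and_sq_of_split hsplit).1
  have hpN : p ∣ N := hf.dvd_level_of_split hsplit
  have hdist := sum_fiber_ratPlusSymbol_eq hrat hf.1 hpN hap
  obtain ⟨C, hC⟩ := exists_norm_ratPlusSymbol_le (p := p) hf.1 hQ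
  obtain ⟨L, hbd, htend, h0, hχ⟩ := exists_powerSeries_of_bounded_distribution'
    (μ := fun n a ↦ (ratPlusSymbol f ((a.val : ℚ) / (p : ℚ) ^ n) : ℚ_[p])) hdist hC
  refine ⟨L, ⟨memIwasawaRat_of_forall_norm_coeff_le hbd, ?_, fun m hm χ _ heven hord ↦ ?_⟩, ?_⟩
  · rw [h0, sum_units_ratPlusSymbol_eq_zero hrat hf.1 hpN hap, inv_one, sub_self,
      zero_pow two_ne_zero, zero_mul]
  · obtain ⟨m, rfl⟩ := Nat.exists_eq_succ_of_ne_zero hm.ne'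
    rw [inv_one, one_pow, map_one, one_mul, ← sum_mul_algebraMap_ratPlusSymbol_eq]
    exact hχ m χ heven hord
  · refine subst_eq_of_measure_symmetry (fun _ _ ↦ rfl) ⟨C, hC⟩ htend (fun n u u' h ↦ ?_) hc hι
    have hL : 1 ≤ n + cyclotomicExponent p :=
      le_add_left (Nat.pos_of_ne_zero (cyclotomicExponent_ne_zero p))
    have k := ratPlusSymbol_eq_mul_of_atkinLehner_of_dvd (f := f) hNM hpM hσ hW hL h
    rw [k]
    push_cast
    rfl

/-- **Functional equation at a NON-split multiplicative prime, for the Mellin transform of the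
measure** `μ_n(a) = (-1)^n [a/p^n]⁺` (`α = a_p = -1`): some `L` with `IsMultPAdicLFunctionOf f p (-1) L`
satisfies `L(ι(T)) = σ (1+T)^c L(T)` (same proof as the split case, with the signed measure of
`exists_isMultPAdicLFunctionOf_neg_one_of_nonsplit`). [cite: MazurTateTeitelbaum1986Invent, §I.10 Prop., §I.14 (14.3), §I.17] -/
theorem exists_isMultPAdicLFunctionOf_neg_one_subst_eq (hf : IsNewformOf W f)
    (hmult : W.HasMultiplicativeReductionAtPrime p)
    (hns : ¬ W.HasSplitMultiplicativeReductionAtPrime p) (hNM : N = p * M) (hpM : ¬ p ∣ M)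
    {σ : ℤ} (hσ : σ ^ 2 = 1) (hW : atkinLehnerInvolution N 2 M f = (-(σ : ℂ)) • f)
    {ηM : rootsOfUnity (torsionOrder p) ℤ_[p]} {c : ℤ_[p]}
    (hc : ∀ n : ℕ, PadicInt.toZModPow (n + cyclotomicExponent p) ((ηM : ℤ_[p]ˣ) : ℤ_[p]) *
        (cyclotomicGenerator p : ZMod (p ^ (n + cyclotomicExponent p))) ^ (PadicInt.toZModPow n c).val =
          (M : ZMod (p ^ (n + cyclotomicExponent p))))
    {ι : ℚ_[p]⟦X⟧} (hι : (1 + X : ℚ_[p]⟦X⟧) * (ι + 1) = 1) :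
    ∃ L : PowerSeries ℚ_[p], IsMultPAdicLFunctionOf f p (-1) L ∧
      PowerSeries.subst ι L = C ((σ : ℤ) : ℚ_[p]) * PowerSeries.binomialSeries ℚ_[p] c * L := by
  have hQ : coeffField f = ⊥ := hf.coeffField_eq_bot
  have hrat : ∀ r : ℚ, (ratPlusSymbol f r : ℝ) = normalizedPlusSymbol f r :=
    ratCast_ratPlusSymbol_holds hf.1 hQ
  obtain ⟨hap, hpN⟩ := hf.cuspCoeff_eq_neg_one_and_dvd_of_nonsplit hmult hns
  have hfib := sum_fiber_ratPlusSymbol_eq_neg hrat hf.1 hpN hap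
  have hdist : ∀ (n : ℕ) (a : ZMod (p ^ n)),
      ∑ b ∈ Finset.univ.filter (fun b : ZMod (p ^ (n + 1)) ↦
        ZMod.castHom (pow_dvd_pow p n.le_succ) (ZMod (p ^ n)) b = a),
        (-1 : ℚ_[p]) ^ (n + 1) * (ratPlusSymbol f ((b.val : ℚ) / (p : ℚ) ^ (n + 1)) : ℚ_[p]) =
        (-1 : ℚ_[p]) ^ n * (ratPlusSymbol f ((a.val : ℚ) / (p : ℚ) ^ n) : ℚ_[p]) := by
    intro n a
    rw [← Finset.mul_sum, hfib n a]
    ring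
  obtain ⟨C, hC⟩ := exists_norm_ratPlusSymbol_le (p := p) hf.1 hQ
  have hC' : ∀ (n : ℕ) (a : ZMod (p ^ n)),
      ‖(-1 : ℚ_[p]) ^ n * (ratPlusSymbol f ((a.val : ℚ) / (p : ℚ) ^ n) : ℚ_[p])‖ ≤ C := by
    intro n a
    rw [norm_mul, norm_pow, norm_neg, norm_one, one_pow, one_mul]
    exact hC n a
  obtain ⟨L, hbd, htend, h0, hχ⟩ := exists_powerSeries_of_bounded_distribution'
    (μ := fun n a ↦ (-1 : ℚ_[p]) ^ n * (ratPlusSymbol f ((a.val : ℚ) / (p : ℚ) ^ n) : ℚ_[p]))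
    hdist hC'
  refine ⟨L, ⟨memIwasawaRat_of_forall_norm_coeff_le hbd, ?_, fun m hm χ _ heven hord ↦ ?_⟩, ?_⟩
  · rw [h0, sum_units_signed_ratPlusSymbol_eq hrat hf.1 hpN hap]
    norm_num
  · obtain ⟨m, rfl⟩ := Nat.exists_eq_succ_of_ne_zero hm.ne'
    have h := hχ m χ heven hord
    have hrhs : (∑ a : ZMod (p ^ (m + 1)), χ a * algebraMap ℚ_[p] ℂ_[p]
        ((-1 : ℚ_[p]) ^ (m + 1) * (ratPlusSymbol f ((a.val : ℚ) / (p : ℚ) ^ (m + 1)) : ℚ_[p]))) =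
        algebraMap ℚ_[p] ℂ_[p] ((-1 : ℚ_[p])⁻¹ ^ (m + 1)) * ratTwistedSymbolSum f χ := by
      rw [← sum_mul_algebraMap_ratPlusSymbol_eq, Finset.mul_sum, inv_neg, inv_one]
      refine Finset.sum_congr rfl fun a _ ↦ ?_
      rw [map_mul]
      ring
    rw [hrhs] at h
    exact h
  · refine subst_eq_of_measure_symmetry (fun _ _ ↦ rfl) ⟨C, hC'⟩ htend (fun n u u' h ↦ ?_) hc hι
    have hL : 1 ≤ n + cyclotomicExponent p :=
      le_add_left (Nat.pos_of_ne_zero (cyclotomicExponent_ne_zero p))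
    have k := ratPlusSymbol_eq_mul_of_atkinLehner_of_dvd (f := f) hNM hpM hσ hW hL h
    rw [k]
    push_cast
    ring

omit [NeZero N] in
/-- **Uniqueness for the non-split package** (the twin of `existsUnique_isSplitMultPAdicLFunctionOf_holds`):
two `L` with `IsMultPAdicLFunctionOf f p α L` coincide — both lie in `Λ ⊗ ℚ_p` and agree at every
`χ(γ) - 1`, `χ` primitive of conductor `p^{k+3}` (`MemIwasawaRat.eq_zero_of_forall_hasSum_zero`).
[cite: MazurTateTeitelbaum1986Invent, §I.14 (14.3)] -/
theorem IsMultPAdicLFunctionOf.unique {α : ℚ_[p]} {L L' : PowerSeries ℚ_[p]}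
    (hL : IsMultPAdicLFunctionOf f p α L) (hL' : IsMultPAdicLFunctionOf f p α L') : L = L' := by
  have hD : L - L' = 0 := by
    refine MemIwasawaRat.eq_zero_of_forall_hasSum_zero (hL.1.sub hL'.1) fun k χ hχ heven hord ↦ ?_
    have h1 := hL.2.2 (k + 3) (Nat.succ_pos _) χ hχ heven hord
    have h2 := hL'.2.2 (k + 3) (Nat.succ_pos _) χ hχ heven hord
    have h := h1.sub h2
    rw [sub_self] at h
    refine h.congr_fun fun i ↦ ?_
    rw [map_sub, map_sub, sub_mul]
  exact sub_eq_zero.mp hD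

/-- **Functional equation of THE `p`-adic `L`-function at a split multiplicative prime `p ‖ N`**
(Mazur–Tate–Teitelbaum 1986, §I.17): every `L` with `IsSplitMultPAdicLFunctionOf f p L` satisfies
`L(ι(T)) = σ · (1+T)^c · L(T)`, where `N = pM`, `p ∤ M`, `w_M f = -σ f`, `⟨M⟩ = γ^c`,
`ι = (1+T)⁻¹ - 1` (by uniqueness of the package, `existsUnique_isSplitMultPAdicLFunctionOf_holds`).
For the newform of `E`: `σ = -ε_M = -a_p(E)·w_E = -w_E` — the OPPOSITE of the complex sign (the
trivial zero). [cite: MazurTateTeitelbaum1986Invent, §I.17] -/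
theorem IsSplitMultPAdicLFunctionOf.subst_eq_of_atkinLehner
    (hsplit : W.HasSplitMultiplicativeReductionAtPrime p)
    (hf : IsNewformOf W f) (hNM : N = p * M) (hpM : ¬ p ∣ M) {σ : ℤ} (hσ : σ ^ 2 = 1)
    (hW : atkinLehnerInvolution N 2 M f = (-(σ : ℂ)) • f)
    {ηM : rootsOfUnity (torsionOrder p) ℤ_[p]} {c : ℤ_[p]}
    (hc : ∀ n : ℕ, PadicInt.toZModPow (n + cyclotomicExponent p) ((ηM : ℤ_[p]ˣ) : ℤ_[p]) *
        (cyclotomicGenerator p : ZMod (p ^ (n + cyclotomicExponent p))) ^ (PadicInt.toZModPow n c).val =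
          (M : ZMod (p ^ (n + cyclotomicExponent p))))
    {ι : ℚ_[p]⟦X⟧} (hι : (1 + X : ℚ_[p]⟦X⟧) * (ι + 1) = 1)
    {L : PowerSeries ℚ_[p]} (hL : IsSplitMultPAdicLFunctionOf f p L) :
    PowerSeries.subst ι L = C ((σ : ℤ) : ℚ_[p]) * PowerSeries.binomialSeries ℚ_[p] c * L := by
  obtain ⟨L₁, hL₁, hFE⟩ := exists_isSplitMultPAdicLFunctionOf_subst_eq hsplit hf hNM hpM hσ hW hc hι
  have heq : L = L₁ := (existsUnique_isSplitMultPAdicLFunctionOf_holds hsplit hf).unique hL hL₁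
  rw [heq]
  exact hFE

/-- **Functional equation of THE `p`-adic `L`-function at a non-split multiplicative prime `p ‖ N`**
(Mazur–Tate–Teitelbaum 1986, §I.17): every `L` with `IsMultPAdicLFunctionOf f p (-1) L` satisfies
`L(ι(T)) = σ · (1+T)^c · L(T)` (`w_M f = -σ f`, `⟨M⟩ = γ^c`). For the newform of `E`:
`σ = -ε_M = -a_p(E)·w_E = w_E`, the complex sign. [cite: MazurTateTeitelbaum1986Invent, §I.17] -/
theorem IsMultPAdicLFunctionOf.subst_eq_of_atkinLehner (hf : IsNewformOf W f)
    (hmult : W.HasMultiplicativeReductionAtPrime p)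
    (hns : ¬ W.HasSplitMultiplicativeReductionAtPrime p) (hNM : N = p * M) (hpM : ¬ p ∣ M)
    {σ : ℤ} (hσ : σ ^ 2 = 1) (hW : atkinLehnerInvolution N 2 M f = (-(σ : ℂ)) • f)
    {ηM : rootsOfUnity (torsionOrder p) ℤ_[p]} {c : ℤ_[p]}
    (hc : ∀ n : ℕ, PadicInt.toZModPow (n + cyclotomicExponent p) ((ηM : ℤ_[p]ˣ) : ℤ_[p]) *
        (cyclotomicGenerator p : ZMod (p ^ (n + cyclotomicExponent p))) ^ (PadicInt.toZModPow n c).val =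
          (M : ZMod (p ^ (n + cyclotomicExponent p))))
    {ι : ℚ_[p]⟦X⟧} (hι : (1 + X : ℚ_[p]⟦X⟧) * (ι + 1) = 1)
    {L : PowerSeries ℚ_[p]} (hL : IsMultPAdicLFunctionOf f p (-1) L) :
    PowerSeries.subst ι L = C ((σ : ℤ) : ℚ_[p]) * PowerSeries.binomialSeries ℚ_[p] c * L := by
  obtain ⟨L₁, hL₁, hFE⟩ :=
    exists_isMultPAdicLFunctionOf_neg_one_subst_eq hf hmult hns hNM hpM hσ hW hc hι
  rw [hL.unique hL₁]
  exact hFE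

end Main

end Literature.NumberTheory.EllipticCurves

end
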